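import Summits.AtomisticToContinuum.HydrodynamicLimit.Theorems.CollisionIsometryCLTAdaptedWeightCLTTLPastDampingDecomposition
import Summits.AtomisticToContinuum.HydrodynamicLimit.Theorems.CollisionIsometryCLTAdaptedWeightCLTTLStubFlowDictionary
import Literature.Analysis.FluidPDE.HardSpherePhaseSpaceProofs

/-!
# Stub `stub_pastDamping` of the line `contact-source-duhamel` — helper file: HAND-OVERS AND FLIGHTS
of the carrier masses (crux `CollisionIsometryCLT.AdaptedWeightCLT`, stmt-AtomisticToContinuum-14868,
`--supports`)

First half of the LOCALITY input of the PAST estimate (the re-cut of wave 1,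
`…TLPastDampingInput.lean`; second half: `…TLPastDampingLocality.lean`). The incoherent transport
moves mass in SPACE only by free flights of its carriers and by hand-overs across the contact
distance `ε_N = hsDiameter σ N`:

* ONE TRANSPORT STEP MOVES MASS ONLY ACROSS THE REFLECTED PAIR (`sum_massAt_succ_mul_le`): paired
  with any function `f` on the carriers, the masses after step `l` exceed those before by at most
  `(mass on the pair) · |f p − f q|` — the traced tangential and normal parts `tr Q T Q`, `tr P T P`
  of the (positive) one-site tensors are non-negative and add up to the mass, piece by piece;
* POSITIONS ALONG THE FOLD: collisions do not move particles (`stA_succ_fst`), a flight of duration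
  `τ_l` moves carrier `i` by at most `τ_l ‖v_i^{(l)}‖` in minimal-image distance
  (`euclidDist_pre_stA_le`, regular geometry), and the reflected pair is at contact, distance
  exactly `ε_N` (`euclidDist_pre_of_stepPair`).
-/

namespace Summit.AtomisticToContinuum.HydrodynamicLimit.Theorems.ContactSourceDuhamel.TimeLocal
namespace PastDamping

open scoped BigOperators Topology Classical MeasureTheory ENNReal InnerProductSpace
open Filter Set MeasureTheory
open Literature.Analysis.FluidPDE
open Literature.MathematicalPhysics.KineticTheory (hsDiameter hsDiameter_pos hsDiameter_le)
open Duhamel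
open Summit.AtomisticToContinuum.HydrodynamicLimit.Theorems.AdaptedWeightCLTNegative (baseV_apply)
open ColumnDepolarisation (pieceCar pieceVec norm_sq_projV_add_coprojV)

noncomputable section

variable {σ : ℝ} {N : ℕ} {y : Cfg N}

/-! ## One transport step moves mass only across the reflected pair -/

/-- `mapT M` commutes with finite sums. -/
theorem mapT_sum {r : ℕ} {ι : Type*} (M : Mat3) (s : Finset ι) (A : ι → Tens r) :
    mapT M (∑ l ∈ s, A l) = ∑ l ∈ s, mapT M (A l) :=
  map_sum (⟨⟨mapT M, mapT_zero M⟩, mapT_add M⟩ : Tens r →+ Tens r) A s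

/-- The traced tangential and normal parts of the one-site transport on a carrier are
non-negative and add up to its mass (piece by piece, `‖Q b‖² + ‖P b‖² = ‖b‖²`). -/
theorem trT_parts_oneSite (l : ℕ) (k i : Fin (N + 1)) (a n : V3) :
    0 ≤ trT (mapT (coprojM n) (tTransport 2 σ N y 0 l (Pi.single k (tpow 2 a)) i)) ∧
      0 ≤ trT (mapT (projM n) (tTransport 2 σ N y 0 l (Pi.single k (tpow 2 a)) i)) ∧
      trT (mapT (coprojM n) (tTransport 2 σ N y 0 l (Pi.single k (tpow 2 a)) i)) +
          trT (mapT (projM n) (tTransport 2 σ N y 0 l (Pi.single k (tpow 2 a)) i)) =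
        massAt σ N y l k a i := by
  rw [oneSite_eq_sum_filter two_pos, mapT_sum, mapT_sum, massAt_eq]
  simp only [mapT_coprojM_tpow, mapT_projM_tpow, trT_sum_tpow_two]
  refine ⟨Finset.sum_nonneg fun w _ => sq_nonneg _, Finset.sum_nonneg fun w _ => sq_nonneg _, ?_⟩
  rw [← Finset.sum_add_distrib]
  refine Finset.sum_congr rfl fun w _ => ?_
  rw [add_comm]
  exact norm_sq_projV_add_coprojV n _

/-- The JUMP COST of fold step `l` for the site `k`, impulse `a` and a function `f` on carriers:
the mass on the reflected pair times the increment of `f` across it (`0` at an identity step). -/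
def jumpAt (σ : ℝ) (N : ℕ) (y : Cfg N) (l : ℕ) (k : Fin (N + 1)) (a : V3)
    (f : Fin (N + 1) → ℝ) : ℝ :=
  match stepPair σ N y l with
  | none => 0
  | some pq => (massAt σ N y l k a pq.1 + massAt σ N y l k a pq.2) * |f pq.1 - f pq.2|

/-- A sum over the carriers, two of them singled out. -/
theorem sum_eq_add_add_sum_erase {p q : Fin (N + 1)} (hpq : p ≠ q) (g : Fin (N + 1) → ℝ) :
    ∑ i, g i = g p + g q + ∑ i ∈ (Finset.univ.erase p).erase q, g i := by
  rw [← Finset.add_sum_erase _ _ (Finset.mem_univ p),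
    ← Finset.add_sum_erase _ _ (Finset.mem_erase.2 ⟨hpq.symm, Finset.mem_univ q⟩), add_assoc]

/-- **One transport step moves mass only across the reflected pair**: paired with any function
`f` on the carriers, the masses after step `l` exceed those before by at most the jump cost. -/
theorem sum_massAt_succ_mul_le (l : ℕ) (k : Fin (N + 1)) (a : V3) (f : Fin (N + 1) → ℝ) :
    ∑ i, massAt σ N y (l + 1) k a i * f i ≤
      ∑ i, massAt σ N y l k a i * f i + jumpAt σ N y l k a f := by
  set F := tTransport 2 σ N y 0 l (Pi.single k (tpow 2 a)) with hF
  have hsucc : ∀ i, massAt σ N y (l + 1) k a i = trT (tStep 2 σ N y l F i) := by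
    intro i
    rw [massAt, tTransport_succ, zero_add]
  rcases h : stepPair σ N y l with _ | ⟨p, q⟩
  · simp only [jumpAt, h, hsucc, tStep_of_none h, add_zero]
    exact le_of_eq rfl
  · have hpq : p ≠ q := ne_of_lt (stepPair_fst_lt_snd h)
    simp only [jumpAt, h]
    set n := stepNormal σ N y l with hn
    -- the tangential (`α`) and normal (`β`) parts on the two reflected carriers
    obtain ⟨hαp, hβp, hp⟩ := trT_parts_oneSite (σ := σ) (y := y) l k p a n
    obtain ⟨hαq, hβq, hq⟩ := trT_parts_oneSite (σ := σ) (y := y) l k q a n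
    set αp := trT (mapT (coprojM n) (F p))
    set βp := trT (mapT (projM n) (F p))
    set αq := trT (mapT (coprojM n) (F q))
    set βq := trT (mapT (projM n) (F q))
    have hnewp : massAt σ N y (l + 1) k a p = αp + βq := by
      rw [hsucc p, tStep_of_some h, Function.update_of_ne hpq, Function.update_self, trT_add]
    have hnewq : massAt σ N y (l + 1) k a q = αq + βp := by
      rw [hsucc q, tStep_of_some h, Function.update_self, trT_add]
    have hrest : ∀ i ∈ (Finset.univ.erase p).erase q,
        massAt σ N y (l + 1) k a i * f i = massAt σ N y l k a i * f i := by
      intro i hi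
      have hiq : i ≠ q := (Finset.mem_erase.1 hi).1
      have hip : i ≠ p := (Finset.mem_erase.1 (Finset.mem_erase.1 hi).2).1
      rw [hsucc i, tStep_of_some h, Function.update_of_ne hiq, Function.update_of_ne hip, massAt]
    rw [sum_eq_add_add_sum_erase hpq, sum_eq_add_add_sum_erase hpq (fun i => massAt σ N y l k a i * f i),
      Finset.sum_congr rfl hrest, hnewp, hnewq, ← hp, ← hq]
    have h1 : (βq - βp) * (f p - f q) ≤ |βq - βp| * |f p - f q| := by
      rw [← abs_mul]; exact le_abs_self _
    have h2 : |βq - βp| ≤ αp + βp + (αq + βq) := by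
      rw [abs_le]; constructor <;> linarith
    nlinarith [abs_nonneg (f p - f q), mul_le_mul_of_nonneg_right h2 (abs_nonneg (f p - f q))]

/-! ## Positions along the fold -/

/-- The `l`-th post-collisional state of the Alexander construction started at `y`. -/
abbrev stA (σ : ℝ) (N : ℕ) (y : Cfg N) (l : ℕ) : Cfg N :=
  Alexander.stateAfter (Torus.geometry (Fin 3)) (hsDiameter σ N) y l

/-- The duration of the `l`-th free flight (in `[0, ∞]`). -/
abbrev tauA (σ : ℝ) (N : ℕ) (y : Cfg N) (l : ℕ) : ℝ≥0∞ :=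
  Alexander.freeExitTime (Torus.geometry (Fin 3)) (hsDiameter σ N) (stA σ N y l)

/-- Collisions do not move particles: the positions of the `(l+1)`-th state are those of the
pre-collisional configuration `pre l` ending the `l`-th flight (also when the flight never ends). -/
theorem stA_succ_fst (l : ℕ) (i : Fin (N + 1)) : (stA σ N y (l + 1) i).1 = (pre σ N y l i).1 := by
  show (Alexander.stateAfter (Torus.geometry (Fin 3)) (hsDiameter σ N) y (l + 1) i).1 = _
  rw [Alexander.stateAfter_succ]
  unfold Alexander.collisionStep
  by_cases htop : Alexander.freeExitTime (Torus.geometry (Fin 3)) (hsDiameter σ N)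
      (Alexander.stateAfter (Torus.geometry (Fin 3)) (hsDiameter σ N) y l) = ∞
  · rw [if_pos htop, FlowDict.pre_of_eq_top y l htop]
  · rw [if_neg htop]
    by_cases hne : (Alexander.incomingPairs (Torus.geometry (Fin 3)) (hsDiameter σ N)
        (pre σ N y l)).Nonempty
    · have hne' : (Alexander.incomingPairs (Torus.geometry (Fin 3)) (hsDiameter σ N)
          (freeFlight (Torus.geometry (Fin 3))
            (Alexander.freeExitTime (Torus.geometry (Fin 3)) (hsDiameter σ N)
              (Alexander.stateAfter (Torus.geometry (Fin 3)) (hsDiameter σ N) y l)).toReal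
            (Alexander.stateAfter (Torus.geometry (Fin 3)) (hsDiameter σ N) y l))).Nonempty := hne
      rw [dif_pos hne', collidePair_apply_fst]
      rfl
    · have hne' : ¬(Alexander.incomingPairs (Torus.geometry (Fin 3)) (hsDiameter σ N)
          (freeFlight (Torus.geometry (Fin 3))
            (Alexander.freeExitTime (Torus.geometry (Fin 3)) (hsDiameter σ N)
              (Alexander.stateAfter (Torus.geometry (Fin 3)) (hsDiameter σ N) y l)).toReal
            (Alexander.stateAfter (Torus.geometry (Fin 3)) (hsDiameter σ N) y l))).Nonempty := hne
      rw [dif_neg hne']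
      rfl

/-- A translate by `proj a` is at minimal-image distance at most `‖a‖` from the point. -/
theorem euclidDist_translate_le (x : T3) (a : V3) :
    Torus.euclidDist (x + Literature.Analysis.FunctionSpaces.Torus.proj a) x ≤ ‖a‖ := by
  have h := Torus.euclidDist_proj_le_norm_sub_holds (d := Fin 3) (Torus.reprSym x + a)
    (Torus.reprSym x)
  rwa [Literature.Analysis.FunctionSpaces.Torus.proj_add, Torus.proj_reprSym,
    add_sub_cancel_left] at h

/-- FLIGHTS: during the `l`-th flight carrier `i` moves by at most `τ_l ‖v_i^{(l)}‖` (regular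
geometry, so that the state velocities are the fold velocities `velAfter l`). -/
theorem euclidDist_pre_stA_le
    (hG : (Torus.geometry (Fin 3)).IsHardSphereRegular (hsDiameter σ N)) (l : ℕ)
    (i : Fin (N + 1)) :
    Torus.euclidDist (pre σ N y l i).1 (stA σ N y l i).1 ≤
      (tauA σ N y l).toReal * ‖velAfter σ N y l i‖ := by
  have hv : (stA σ N y l i).2 = velAfter σ N y l i := congrFun (FlowDict.vel_stateAfter hG y l) i
  show Torus.euclidDist ((Torus.geometry (Fin 3)).translate (stA σ N y l i).1
    ((tauA σ N y l).toReal • (stA σ N y l i).2)) (stA σ N y l i).1 ≤ _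
  rw [Torus.geometry_translate, hv]
  refine (euclidDist_translate_le _ _).trans (le_of_eq ?_)
  rw [norm_smul, Real.norm_eq_abs, abs_of_nonneg ENNReal.toReal_nonneg]

/-- HAND-OVERS: the pair reflected at a fold step is at contact, distance exactly `ε_N`. -/
theorem euclidDist_pre_of_stepPair {l : ℕ} {p q : Fin (N + 1)}
    (h : stepPair σ N y l = some (p, q)) :
    Torus.euclidDist (pre σ N y l p).1 (pre σ N y l q).1 = hsDiameter σ N := by
  unfold stepPair at h
  by_cases hne : (Alexander.incomingPairs (Torus.geometry (Fin 3)) (hsDiameter σ N)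
      (pre σ N y l)).Nonempty
  · simp only [dif_pos hne, Option.some.injEq] at h
    have hmem := hne.some_mem
    rw [h] at hmem
    obtain ⟨-, hc, -⟩ := Alexander.mem_incomingPairs.1 hmem
    rw [← Torus.norm_geometry_sepVec]
    exact (mem_contactSet.1 hc).2
  · rw [dif_neg hne] at h
    exact (Option.some_ne_none _ h.symm).elim

/-- Registered anchor of this helper file (the reflected pair is at contact,
`euclidDist_pre_of_stepPair`). -/
theorem pastDamping_handover_anchor : ∀ (σ : ℝ) (N : ℕ) (y : Cfg N) (l : ℕ) (p q : Fin (N + 1)), stepPair σ N y l = some (p, q) → Literature.Analysis.FluidPDE.Torus.euclidDist (pre σ N y l p).1 (pre σ N y l q).1 = Literature.MathematicalPhysics.KineticTheory.hsDiameter σ N :=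
  fun _ _ _ _ _ _ h => euclidDist_pre_of_stepPair h

end

end PastDamping
end Summit.AtomisticToContinuum.HydrodynamicLimit.Theorems.ContactSourceDuhamel.TimeLocal
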